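import Literature.NumberTheory.EllipticCurves.Greenberg1999.TwoTorsionRamifiedAtTwoValuationProofs
import Literature.NumberTheory.EllipticCurves.Greenberg1999.TwoTorsionRamifiedIsogenyDualProofs
import Mathlib.NumberTheory.Padics.Hensel
import HarnessLib

/-!
# Route `TwoAdicConverse` (rung S3), crux `OrdLambdaHalfAtTwo` (item 19556), card `f4-semisimple-cubic-two` — first rung:
# at an ORDINARY `2` the `2`-division cubic has a `ℚ₂`-root of valuation `−2`, and it SPLITS COMPLETELY over `ℚ₂` as soon
# as `Δ` is a `2`-adic square (so on the cubic-image stratum (γ₁), where `Δ ∈ ℚ×²`)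

Cell `bsd-2adic`, seat `bsd-2adic-conv-1` (GEN 21). THEOREMS ONLY — no named fact, no definition, nothing conditional. HONEST
FRAMING: this is the content of the pen-named first rung `stub_cubicImage_twoDivisionSplitsAt_two` of line L2
`f4-semisimple-cubic-two` (PEN-PICK-19556-r1 §2(a): «connected–étale at ordinary 2 ⇒ Borel ∩ C₃ = 1 ⇒ E[2] ⊂ E(ℚ₂)») in the
tree's vocabulary (the card's predicates `HasCubicModTwoImage` / `TwoDivisionSplitsAt` are not in the tree; its
`TwoDivisionSplitsAt W 2` is literally the conclusion of `card_roots_twoTorsionPolynomial_padic_two` below). It says nothing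
about `λ`-invariants; items 19556 / 19218 stay OPEN; BSD is not proved by any of this. PARTITION (D-0054): none — RANK axis (S3).

**Mechanism (elementary, no Galois representations).** For a globally minimal `W/ℚ` with `a₁` ODD (= good ordinary or
multiplicative at `2`, tree `odd_a₁_integralModelInt_of_goodOrd_or_mult`), `b₂ = a₁² + 4a₂` is odd and the monic integer cubic
`u³ + b₂u² + 8b₄u + 16b₆` (`= 16·ψ₂²(u/4)`, `ψ₂² = 4x³ + b₂x² + 2b₄x + b₆` the `2`-division cubic) reduces to `u²(u + 1)` mod `2`:
HENSEL at the simple root `u ≡ 1` gives a `2`-adic unit root `u₀`, i.e. the `2`-division cubic has the root `x₀ = u₀/4 ∈ ℚ₂` with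
`‖x₀‖₂ = 4` (`v₂ = −2`: the abscissa of the generator of Greenberg's `C₂[2]`, the kernel of reduction — compare
`padicValRat_eq_neg_two_of_twoTorsionRamifiedAtTwo_of_goodOrd` for RATIONAL such points). Factor
`ψ₂² = (x − x₀)·(4x² + (4x₀ + b₂)x + (4x₀² + b₂x₀ + 2b₄))`; the EXACT identity
`disc(quadratic)·ψ₂²′(x₀)² = 16Δ + h(x₀)·ψ₂²(x₀)` (`sixteen_mul_Δ_eq_of_root`, `h` an explicit cubic) shows the quadratic
factor's discriminant is `16Δ/ψ₂²′(x₀)²`, a `2`-adic square iff `Δ` is; then the quadratic formula gives the other two roots.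

* `exists_padicInt_root_of_odd` — Hensel: `u³ + B₂u² + 8B₄u + 16B₆` has a unit root in `ℤ₂` for `B₂` odd;
* `exists_padic_root_twoDivisionCubic_of_odd_a₁` — `∃ x₀ ∈ ℚ₂`, `4x₀³ + b₂x₀² + 2b₄x₀ + b₆ = 0`, `‖x₀‖ = 4`;
* `card_roots_twoTorsionPolynomial_padic_two` — if moreover `Δ_W` is a square in `ℚ₂`, the `2`-division cubic has `3` roots in `ℚ₂`
  (`((W.twoTorsionPolynomial.toPoly).map (algebraMap ℚ ℚ_[2])).roots.card = 3`); corollaries `…_of_goodOrd_or_mult_of_isSquare`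
  (leaf currency `GoodOrd W 2 ∨ Mult W 2`, `Δ ∈ ℚ×²` — the (γ₁) cubic-image stratum and the full-`2`-torsion classes).

References: J. H. Silverman, *AEC* (2009), VII.2–VII.3 (kernel of reduction), III.1; R. Greenberg, LNM 1716 (1999) §5 (`C₂`);
K. Conrad / Mathlib `hensels_lemma`. [SilvermanAEC2009] [GreenbergLNM1716]
-/

set_option linter.dupNamespace false
set_option autoImplicit false

noncomputable section

open scoped Classical
open Polynomial WeierstrassCurve Literature.NumberTheory.EllipticCurves Literature.NumberTheory.EllipticCurves.Greenberg1999
  Literature.NumberTheory.EllipticCurves.Rank1Residual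

namespace Summit.BirchSwinnertonDyer.BirchSwinnertonDyer.Theorems.TwoAdicTwistConverse

/-! ## §1. Hensel at the odd root of `u³ + B₂u² + 8B₄u + 16B₆`, `B₂` odd -/

/-- **Hensel**: for `B₂` odd the monic cubic `u³ + B₂u² + 8B₄u + 16B₆ ≡ u²(u+1) (mod 2)` has a root `u₀ ∈ ℤ₂ˣ`
(`F(1) ≡ 0`, `F′(1) = 3 + 2B₂ + 8B₄` odd). [folklore] -/
theorem exists_padicInt_root_of_odd {B₂ B₄ B₆ : ℤ} (hB₂ : Odd B₂) :
    ∃ u : ℤ_[2], ‖u‖ = 1 ∧ (u : ℚ_[2]) ^ 3 + B₂ * (u : ℚ_[2]) ^ 2 + 8 * B₄ * u + 16 * B₆ = 0 := by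
  haveI : Fact (Nat.Prime 2) := ⟨Nat.prime_two⟩
  obtain ⟨B₄', hB₄'⟩ : ∃ t : ℤ, t = 8 * B₄ := ⟨_, rfl⟩
  obtain ⟨B₆', hB₆'⟩ : ∃ t : ℤ, t = 16 * B₆ := ⟨_, rfl⟩
  set F : ℤ[X] := X ^ 3 + C B₂ * X ^ 2 + C B₄' * X + C B₆' with hF
  have hFa : F.aeval (1 : ℤ_[2]) = ((1 + B₂ + B₄' + B₆' : ℤ) : ℤ_[2]) := by
    simp [hF]
  have hF' : F.derivative = C 3 * X ^ 2 + C (2 * B₂) * X + C B₄' := by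
    simp only [hF, derivative_add, derivative_X_pow, derivative_mul, derivative_C, derivative_X, zero_mul,
      zero_add, mul_one, map_mul]
    norm_num
    ring
  have hFa' : F.derivative.aeval (1 : ℤ_[2]) = ((3 + 2 * B₂ + B₄' : ℤ) : ℤ_[2]) := by
    rw [hF']
    simp only [map_add, map_mul, map_pow, aeval_X, map_ofNat, one_pow, mul_one, eq_intCast, map_intCast]
    push_cast
    ring
  have hn1 : ‖F.aeval (1 : ℤ_[2])‖ < 1 := by
    rw [hFa]
    refine (PadicInt.norm_int_lt_one_iff_dvd _).mpr ?_
    obtain ⟨k, hk⟩ := hB₂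
    exact ⟨k + 1 + 4 * B₄ + 8 * B₆, by rw [hk, hB₄', hB₆']; ring⟩
  have hd1 : ‖F.derivative.aeval (1 : ℤ_[2])‖ = 1 := by
    rw [hFa']
    refine le_antisymm (PadicInt.norm_le_one _) (not_lt.mp fun hlt ↦ ?_)
    obtain ⟨k, hk⟩ := (PadicInt.norm_int_lt_one_iff_dvd _).mp hlt
    obtain ⟨j, hj⟩ := hB₂
    omega
  have hnorm : ‖F.aeval (1 : ℤ_[2])‖ < ‖F.derivative.aeval (1 : ℤ_[2])‖ ^ 2 := by
    rw [hd1, one_pow]; exact hn1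
  obtain ⟨z, hz, hz1, -⟩ := hensels_lemma hnorm
  rw [hd1] at hz1
  refine ⟨z, ?_, ?_⟩
  · -- `‖z - 1‖ < 1 ⇒ ‖z‖ = 1`
    refine le_antisymm (PadicInt.norm_le_one _) (not_lt.mp fun hlt ↦ ?_)
    have h1 : (2 : ℤ_[2]) ∣ z := (PadicInt.norm_lt_one_iff_dvd z).mp hlt
    have h2 : (2 : ℤ_[2]) ∣ z - 1 := (PadicInt.norm_lt_one_iff_dvd _).mp hz1
    have h3 : (2 : ℤ_[2]) ∣ 1 := by
      have := dvd_sub h1 h2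
      rwa [sub_sub_cancel] at this
    have : ‖(1 : ℤ_[2])‖ < 1 := (PadicInt.norm_lt_one_iff_dvd _).mpr (by exact_mod_cast h3)
    rw [norm_one] at this
    exact lt_irrefl _ this
  · have h : F.aeval z = z ^ 3 + (B₂ : ℤ_[2]) * z ^ 2 + B₄' * z + B₆' := by
      simp [hF]
    rw [h] at hz
    have := congrArg ((↑) : ℤ_[2] → ℚ_[2]) hz
    push_cast at this
    rw [hB₄', hB₆'] at this
    push_cast at this
    linear_combination this

/-! ## §2. The `2`-division cubic of a curve with `a₁` odd has a `ℚ₂`-root of valuation `−2` -/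

section Curve

variable (W : WeierstrassCurve ℚ) [W.IsElliptic] [W.IsGloballyMinimal]

omit [W.IsElliptic] in
/-- **At `a₁` odd the `2`-division cubic `ψ₂² = 4x³ + b₂x² + 2b₄x + b₆` has a root `x₀ ∈ ℚ₂` with `‖x₀‖₂ = 4`** (`x₀ = u₀/4`
for the Hensel root `u₀ ∈ ℤ₂ˣ` of `u³ + b₂u² + 8b₄u + 16b₆`; `v₂(x₀) = −2` is the abscissa of Greenberg's `C₂[2]` generator).
[folklore] -/
theorem exists_padic_root_twoDivisionCubic_of_odd_a₁ (ha₁ : Odd (integralModelInt W).a₁) :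
    ∃ x : ℚ_[2], 4 * x ^ 3 + (W.b₂ : ℚ_[2]) * x ^ 2 + 2 * (W.b₄ : ℚ_[2]) * x + (W.b₆ : ℚ_[2]) = 0 ∧ ‖x‖ = 4 := by
  haveI : Fact (Nat.Prime 2) := ⟨Nat.prime_two⟩
  obtain ⟨hb₂, hb₄, hb₆⟩ := b₂_b₄_b₆_eq_intCast W
  obtain ⟨u, hu1, hu⟩ := exists_padicInt_root_of_odd (B₄ := (integralModelInt W).b₄)
    (B₆ := (integralModelInt W).b₆) (odd_b₂_integralModelInt_of_odd_a₁ W ha₁)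
  have h4 : (4 : ℚ_[2]) ≠ 0 := by norm_num
  refine ⟨(u : ℚ_[2]) / 4, ?_, ?_⟩
  · rw [hb₂, hb₄, hb₆]
    push_cast
    field_simp
    linear_combination hu
  · have h2 : ‖(2 : ℚ_[2])‖ = 2⁻¹ := by exact_mod_cast Padic.norm_p (p := 2)
    rw [norm_div, show (4 : ℚ_[2]) = 2 * 2 by norm_num, norm_mul, h2, PadicInt.padic_norm_e_of_padicInt, hu1]
    norm_num

omit [W.IsElliptic] [W.IsGloballyMinimal] in
/-- **The discriminant identity behind the splitting**: if `ψ₂²(r) = 4r³ + b₂r² + 2b₄r + b₆ = 0` then, writing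
`ψ₂² = (x − r)(4x² + (4r + b₂)x + (4r² + b₂r + 2b₄))`, one has
`[(4r + b₂)² − 16(4r² + b₂r + 2b₄)]·(12r² + 2b₂r + 2b₄)² = 16Δ` (discriminant of the quadratic cofactor times `ψ₂²′(r)²`;
an exact polynomial identity modulo `ψ₂²(r)`, cofactor `−1728r³ − 432b₂r² − 864b₄r + 4b₂³ − 144b₂b₄ + 432b₆`). Any field.
[folklore] -/
theorem sixteen_mul_Δ_eq_of_root {K : Type*} [Field K] [CharZero K] {r : K}
    (hr : 4 * r ^ 3 + (W.b₂ : K) * r ^ 2 + 2 * (W.b₄ : K) * r + (W.b₆ : K) = 0) :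
    ((4 * r + (W.b₂ : K)) ^ 2 - 16 * (4 * r ^ 2 + (W.b₂ : K) * r + 2 * (W.b₄ : K))) *
        (12 * r ^ 2 + 2 * (W.b₂ : K) * r + 2 * (W.b₄ : K)) ^ 2 = 16 * (W.Δ : K) := by
  have hΔ : (16 * W.Δ : ℚ) =
      -4 * W.b₂ ^ 3 * W.b₆ + 4 * W.b₂ ^ 2 * W.b₄ ^ 2 - 128 * W.b₄ ^ 3 - 432 * W.b₆ ^ 2 + 144 * W.b₂ * W.b₄ * W.b₆ := by
    simp only [WeierstrassCurve.Δ]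
    linear_combination (-4 * W.b₂ ^ 2) * W.b_relation
  have hΔK : (16 * (W.Δ : K)) = -4 * (W.b₂ : K) ^ 3 * W.b₆ + 4 * (W.b₂ : K) ^ 2 * (W.b₄ : K) ^ 2 -
      128 * (W.b₄ : K) ^ 3 - 432 * (W.b₆ : K) ^ 2 + 144 * (W.b₂ : K) * W.b₄ * W.b₆ := by
    have := congrArg (fun q : ℚ ↦ (q : K)) hΔ
    push_cast at this
    exact this
  rw [hΔK]
  linear_combination (-1728 * r ^ 3 - 432 * (W.b₂ : K) * r ^ 2 - 864 * (W.b₄ : K) * r +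
    (4 * (W.b₂ : K) ^ 3 - 144 * (W.b₂ : K) * W.b₄ + 432 * W.b₆)) * hr

/-- **The `2`-division cubic SPLITS COMPLETELY over `ℚ₂` when `a₁` is odd and `Δ` is a `2`-adic square**: its three roots lie
in `ℚ₂` (`roots.card = 3` for `ψ₂²` mapped to `ℚ₂`). One root from Hensel (§2); the quadratic cofactor has discriminant
`16Δ/ψ₂²′(x₀)²`, a square, so the quadratic formula supplies the other two. This is the content of line L2's first rung
`stub_cubicImage_twoDivisionSplitsAt_two` («good ordinary at 2 + cubic (C₃) image ⇒ E[2] ⊂ E(ℚ₂)»: on that stratum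
`Δ ∈ ℚ×² ⊂ ℚ₂×²`). [folklore] -/
theorem card_roots_twoTorsionPolynomial_padic_two (ha₁ : Odd (integralModelInt W).a₁)
    (hΔ : IsSquare ((W.Δ : ℚ) : ℚ_[2])) :
    Multiset.card ((W.twoTorsionPolynomial.toPoly).map (algebraMap ℚ ℚ_[2])).roots = 3 := by
  haveI : Fact (Nat.Prime 2) := ⟨Nat.prime_two⟩
  obtain ⟨r, hr, -⟩ := exists_padic_root_twoDivisionCubic_of_odd_a₁ W ha₁
  obtain ⟨w, hw⟩ := hΔ
  -- abbreviations
  set p : ℚ_[2] := (W.b₂ : ℚ_[2]) with hp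
  set q : ℚ_[2] := (W.b₄ : ℚ_[2]) with hq
  set s : ℚ_[2] := (W.b₆ : ℚ_[2]) with hs
  have hkey : ((4 * r + p) ^ 2 - 16 * (4 * r ^ 2 + p * r + 2 * q)) * (12 * r ^ 2 + 2 * p * r + 2 * q) ^ 2 =
      16 * ((W.Δ : ℚ) : ℚ_[2]) :=
    sixteen_mul_Δ_eq_of_root W hr
  have hΔ0 : ((W.Δ : ℚ) : ℚ_[2]) ≠ 0 := by exact_mod_cast W.isUnit_Δ.ne_zero
  have hG0 : 12 * r ^ 2 + 2 * p * r + 2 * q ≠ 0 := by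
    intro h0
    rw [h0, zero_pow two_ne_zero, mul_zero] at hkey
    exact hΔ0 (by linear_combination -hkey / 16)
  -- the square root of the quadratic cofactor's discriminant
  obtain ⟨sD, hsD2⟩ : ∃ sD : ℚ_[2], sD ^ 2 = (4 * r + p) ^ 2 - 16 * (4 * r ^ 2 + p * r + 2 * q) := by
    refine ⟨4 * w / (12 * r ^ 2 + 2 * p * r + 2 * q), ?_⟩
    rw [div_pow, div_eq_iff (pow_ne_zero _ hG0)]
    linear_combination -hkey - 16 * hw
  set r₂ : ℚ_[2] := (-(4 * r + p) + sD) / 8 with hr₂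
  set r₃ : ℚ_[2] := (-(4 * r + p) - sD) / 8 with hr₃
  -- the factorisation `ψ₂² = 4(x − r)(x − r₂)(x − r₃)` over `ℚ₂`
  have hpoly : (W.twoTorsionPolynomial.toPoly).map (algebraMap ℚ ℚ_[2]) =
      C (4 : ℚ_[2]) * (X - C r) * (X - C r₂) * (X - C r₃) := by
    rw [Cubic.C_mul_prod_X_sub_C_eq, ← Cubic.map_toPoly]
    congr 1
    simp only [Cubic.map, WeierstrassCurve.twoTorsionPolynomial, eq_ratCast]
    ext
    · norm_num
    · show (W.b₂ : ℚ_[2]) = 4 * -(r + r₂ + r₃)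
      rw [hr₂, hr₃, ← hp]; ring
    · show ((2 * W.b₄ : ℚ) : ℚ_[2]) = 4 * (r * r₂ + r * r₃ + r₂ * r₃)
      push_cast
      rw [← hq, hr₂, hr₃]
      linear_combination (1 / 16 : ℚ_[2]) * hsD2
    · show (W.b₆ : ℚ_[2]) = 4 * -(r * r₂ * r₃)
      rw [← hs, hr₂, hr₃]
      linear_combination hr - (r / 16) * hsD2
  rw [hpoly, roots_mul, roots_mul, roots_C_mul _ (by norm_num), roots_X_sub_C, roots_X_sub_C, roots_X_sub_C]
  · rfl
  · exact mul_ne_zero (mul_ne_zero (C_ne_zero.mpr (by norm_num)) (X_sub_C_ne_zero r)) (X_sub_C_ne_zero r₂)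
  · exact mul_ne_zero (mul_ne_zero (mul_ne_zero (C_ne_zero.mpr (by norm_num)) (X_sub_C_ne_zero r))
      (X_sub_C_ne_zero r₂)) (X_sub_C_ne_zero r₃)

/-- **Leaf currency**: for `W` good ORDINARY or MULTIPLICATIVE at `2` (`a₁` odd) the `2`-division cubic has a `ℚ₂`-root of
valuation `−2`. [folklore] -/
theorem exists_padic_root_twoDivisionCubic_of_goodOrd_or_mult (hW : GoodOrd W 2 ∨ Mult W 2) :
    ∃ x : ℚ_[2], 4 * x ^ 3 + (W.b₂ : ℚ_[2]) * x ^ 2 + 2 * (W.b₄ : ℚ_[2]) * x + (W.b₆ : ℚ_[2]) = 0 ∧ ‖x‖ = 4 :=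
  exists_padic_root_twoDivisionCubic_of_odd_a₁ W (odd_a₁_integralModelInt_of_goodOrd_or_mult W hW)

/-- **Leaf currency, (γ₁) / full-`2`-torsion strata**: for `W` good ordinary or multiplicative at `2` with `Δ_W ∈ ℚ×²`
(cubic mod-`2` image `C₃`, or `E[2] ⊂ E(ℚ)`), the `2`-division cubic splits completely over `ℚ₂`: `E[2] ⊂ E(ℚ₂)`, i.e. `2` splits
completely in `ℚ(E[2])`. [folklore] -/
theorem card_roots_twoTorsionPolynomial_padic_two_of_goodOrd_or_mult_of_isSquare (hW : GoodOrd W 2 ∨ Mult W 2)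
    (hΔ : IsSquare W.Δ) :
    Multiset.card ((W.twoTorsionPolynomial.toPoly).map (algebraMap ℚ ℚ_[2])).roots = 3 := by
  refine card_roots_twoTorsionPolynomial_padic_two W (odd_a₁_integralModelInt_of_goodOrd_or_mult W hW) ?_
  obtain ⟨v, hv⟩ := hΔ
  exact ⟨(v : ℚ_[2]), by rw [hv]; push_cast; ring⟩

end Curve

end Summit.BirchSwinnertonDyer.BirchSwinnertonDyer.Theorems.TwoAdicTwistConverse

end
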